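import Summits.ResolutionOfSingularities.ResolutionOfSingularities.Theorems.FrobeniusLadderFRationalResolutionSegreVertexUnique
import Summits.ResolutionOfSingularities.ResolutionOfSingularities.Theorems.FrobeniusLadderFRationalResolutionSegreMemIff
import Summits.ResolutionOfSingularities.ResolutionOfSingularities.Theorems.FrobeniusLadderFRationalResolutionSegreConeClass
import Summits.ResolutionOfSingularities.ResolutionOfSingularities.Theorems.FrobeniusLadderFRationalResolutionSegreConeResolution
import Summits.ResolutionOfSingularities.ResolutionOfSingularities.Theorems.FrobeniusLadderFRationalResolutionVeroneseVertexSingular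
import Literature.AlgebraicGeometry.Resolution.AffineDomainDimension
import Mathlib.Algebra.MonoidAlgebra.MapDomain
import Mathlib.RingTheory.AlgebraicIndependent.TranscendenceBasis
import HarnessLib

/-!
# Cone programme, Segre family: the vertex of `C(ℙᵃ⁻¹ × ℙᵇ⁻¹)` is singular (`a, b ≥ 2`), and the packaged statement

Support file for crux stmt-ResolutionOfSingularities-15317 (`FrobeniusLadder.FRationalResolution`), line `redirect`,
CONE PROGRAMME (rung 4′ in all dimensions on the Segre cones `Spec k[xᵢyⱼ]`; the Segre twin of
`…VeroneseVertexSingular.lean` / `…VeroneseConePackage.lean`). For the Segre ring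
`SR[a,b] = k[xᵢyⱼ] ⊆ k[x₁,…,x_a,y₁,…,y_b]`:

* `segre_exists_injective_algHom` / `segre_ringKrullDim_le` — **`dim SR[a,b] ≤ a + b − 1`**: the dehomogenisation
  `x_{i₀} ↦ 1` is a `k`-algebra map `SR[a,b] → k[T_v : v ≠ inl i₀]` which is INJECTIVE on `SR[a,b]` (composed with the
  monomial map `T_{inl i} ↦ χ^{ε_{inl i} − ε_{inl i₀}}`, `T_{inr j} ↦ χ^{ε_{inl i₀} + ε_{inr j}}` into the Laurent ring
  `k[ℤ^{a+b}]` it is the torus embedding `SR[a,b] ⊆ k[x,y] ⊆ k[ℤ^{a+b}]`, checked on the generators `xᵢyⱼ`), so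
  `trdeg_k SR[a,b] ≤ a + b − 1` (`trdeg_le_of_injective`, `MvPolynomial.trdeg_of_isDomain`) and `dim = trdeg` for affine
  domains (`Literature.…exists_ringKrullDim_eq_and_trdeg_eq`, Matsumura Thm. 5.6);
* `segreSing_vertex_not_regular` — for `a, b ≥ 2` the local ring of `SR[a,b]` at the vertex `q` (a prime containing every
  `xᵢyⱼ`; `t ∈ q ↔ t(0) = 0`, `segreVertex_mem_iff`) is NOT regular whenever `dim SR[a,b] ≤ m < ab`: denominator clearing
  (`veronese_not_isRegularRing_exists_finset`) and degree-`2` components (elements of `SR[a,b]` have only BALANCED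
  monomials, `segreMemIff_balanced_of_mem`, hence none of degree `1`; `veroneseSing_homogeneousComponent_mul` with `r = 2`)
  put the `ab` linearly independent monomials `xᵢyⱼ ∈ q` in a span of `≤ m` vectors;
* `segreCone_not_isRegularRing` — hence `SR[a,b]` is not a regular ring for `a, b ≥ 2` (`a + b − 1 < ab`);
* `segreCone_singular_residualClass_hasResolution` — with `segreCone_residualClass` (p795533) and `hasResolution_segreCone`
  (p795206): for every prime `p`, every field of characteristic `p` and all `a, b ≥ 2` the Segre cone is a SINGULAR member
  of the residual class of the crux (domain, every ideal tightly closed) WITH a resolution of singularities in Lean —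
  dimension `a + b − 1`, not ℚ-Gorenstein for `a ≠ b`.
[folklore; cf. BrunsHerzog1998, Ex. 2.2.24 and §6.1; Matsumura1987, Thm. 5.6, §14] Only Mathlib and the landed tree files
above are used; no named published fact.
-/

-- single-problem summit: the doubled namespace component is forced
set_option linter.dupNamespace false

noncomputable section

namespace Summit.ResolutionOfSingularities.ResolutionOfSingularities.Theorems.FRationalResolution

open MvPolynomial AlgebraicGeometry
open Literature.AlgebraicGeometry.Resolution

section Cones

variable (k : Type) [Field k]

/-- The polynomial ring in two blocks of `a` and `b` variables `xᵢ = X (inl i)`, `yⱼ = X (inr j)`. -/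
local notation3 "SP[" a ", " b "]" => MvPolynomial (Fin a ⊕ Fin b) k

/-- The Segre ring `k[xᵢyⱼ] ⊆ k[x, y]`: coordinate ring of the affine cone over the Segre embedding of
`ℙᵃ⁻¹ × ℙᵇ⁻¹`. -/
local notation3 "SR[" a ", " b "]" =>
  Algebra.adjoin k (Set.range (fun ij : Fin a × Fin b =>
    (MvPolynomial.X (Sum.inl ij.1) * MvPolynomial.X (Sum.inr ij.2) : MvPolynomial (Fin a ⊕ Fin b) k)))

/-- The Laurent polynomial ring `k[ℤ^{a+b}]` (coordinate ring of the `(a+b)`-torus). -/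
local notation3 "LR[" a ", " b "]" => AddMonoidAlgebra k (Fin a ⊕ Fin b →₀ ℤ)

/-! ## The dimension bound `dim SR[a,b] ≤ a + b - 1` -/

/-- **The dehomogenisation `x_{i₀} ↦ 1` is injective on the Segre ring.** There is an injective `k`-algebra map
`SR[a,b] → k[T_v : v ≠ inl i₀]` (`xᵢ ↦ Tᵢ` for `i ≠ i₀`, `x_{i₀} ↦ 1`, `yⱼ ↦ Tⱼ`): composed with the monomial map
`ρ : T_{inl i} ↦ χ^{ε_{inl i} − ε_{inl i₀}}`, `T_{inr j} ↦ χ^{ε_{inl i₀} + ε_{inr j}}` into the Laurent ring `k[ℤ^{a+b}]` it agrees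
with the (injective) torus embedding `k[x,y] ⊆ k[ℤ^{a+b}]` on every generator `xᵢyⱼ`, hence on `SR[a,b]`
(`Algebra.adjoin_induction`). [folklore] -/
theorem segre_exists_injective_algHom (a b : ℕ) (i₀ : Fin a) :
    ∃ ψ : ↥SR[a, b] →ₐ[k] MvPolynomial {v : Fin a ⊕ Fin b // v ≠ Sum.inl i₀} k, Function.Injective ψ := by
  classical
  -- the dehomogenisation `x_{i₀} ↦ 1`
  let θ : Fin a ⊕ Fin b → MvPolynomial {v : Fin a ⊕ Fin b // v ≠ Sum.inl i₀} k := fun v =>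
    if h : v = Sum.inl i₀ then 1 else X ⟨v, h⟩
  let ψ : SP[a, b] →ₐ[k] MvPolynomial {v : Fin a ⊕ Fin b // v ≠ Sum.inl i₀} k := aeval θ
  refine ⟨ψ.comp (SR[a, b]).val, ?_⟩
  -- the torus embedding `Λ : k[x,y] → k[ℤ^{a+b}]` (injective)
  let ι : (Fin a ⊕ Fin b →₀ ℕ) →+ (Fin a ⊕ Fin b →₀ ℤ) := Finsupp.mapRange.addMonoidHom (Nat.castAddMonoidHom ℤ)
  have hι : Function.Injective ι := Finsupp.mapRange_injective _ (by simp) Nat.cast_injective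
  let Λ : SP[a, b] →+* LR[a, b] := AddMonoidAlgebra.mapDomainRingHom k ι
  have hΛ : ∀ f : SP[a, b], Λ f = AddMonoidAlgebra.mapDomain ι f := fun f => rfl
  have hΛinj : Function.Injective Λ := fun f g h => AddMonoidAlgebra.mapDomain_injective hι h
  -- the rehomogenisation `ρ : k[T_v : v ≠ inl i₀] → k[ℤ^{a+b}]`
  let w : {v : Fin a ⊕ Fin b // v ≠ Sum.inl i₀} → (Fin a ⊕ Fin b →₀ ℤ) := fun v =>
    Sum.elim (fun i => Finsupp.single (Sum.inl i) (1 : ℤ) - Finsupp.single (Sum.inl i₀) 1)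
      (fun j => Finsupp.single (Sum.inl i₀) (1 : ℤ) + Finsupp.single (Sum.inr j) 1) v.1
  let ρ : MvPolynomial {v : Fin a ⊕ Fin b // v ≠ Sum.inl i₀} k →ₐ[k] LR[a, b] :=
    aeval fun v => (AddMonoidAlgebra.single (w v) (1 : k) : LR[a, b])
  have hΛC : ∀ c : k, Λ (C c) = algebraMap k LR[a, b] c := by
    intro c
    rw [hΛ, C_apply, ← single_eq_monomial, AddMonoidAlgebra.mapDomain_single, map_zero]
    rfl
  have hΛX : ∀ (i : Fin a) (j : Fin b), Λ (X (Sum.inl i) * X (Sum.inr j)) =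
      AddMonoidAlgebra.single (Finsupp.single (Sum.inl i) (1 : ℤ) + Finsupp.single (Sum.inr j) 1) 1 := by
    intro i j
    rw [hΛ, segreMemIff_X_mul_X_eq_monomial, ← single_eq_monomial, AddMonoidAlgebra.mapDomain_single]
    congr 1
    simp only [ι, map_add, Finsupp.mapRange.addMonoidHom_apply, Finsupp.mapRange_single, Nat.coe_castAddMonoidHom,
      Nat.cast_one]
  -- `ρ ∘ ψ = Λ` on `SR[a,b]`
  have hagree : ∀ f : SP[a, b], f ∈ SR[a, b] → ρ (ψ f) = Λ f := by
    intro f hf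
    induction hf using Algebra.adjoin_induction with
    | mem x hx =>
      obtain ⟨⟨i, j⟩, rfl⟩ := hx
      have hy : ρ (ψ (X (Sum.inr j))) =
          AddMonoidAlgebra.single (Finsupp.single (Sum.inl i₀) (1 : ℤ) + Finsupp.single (Sum.inr j) 1) 1 := by
        simp only [ψ, aeval_X, θ, dif_neg Sum.inr_ne_inl, ρ, w, Sum.elim_inr]
      rw [hΛX, map_mul, map_mul, hy]
      by_cases hi : i = i₀
      · subst hi
        have h1 : ψ (X (Sum.inl i)) = 1 := by
          simp only [ψ, aeval_X, θ, dite_true]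
        rw [h1, map_one, one_mul]
      · have hne : (Sum.inl i : Fin a ⊕ Fin b) ≠ Sum.inl i₀ := fun e => hi (Sum.inl_injective e)
        have hx : ρ (ψ (X (Sum.inl i))) =
            AddMonoidAlgebra.single (Finsupp.single (Sum.inl i) (1 : ℤ) - Finsupp.single (Sum.inl i₀) 1) 1 := by
          simp only [ψ, aeval_X, θ, dif_neg hne, ρ, w, Sum.elim_inl]
        rw [hx, AddMonoidAlgebra.single_mul_single, mul_one]
        congr 1
        abel
    | algebraMap c =>
      rw [AlgHom.commutes, AlgHom.commutes, MvPolynomial.algebraMap_eq, hΛC]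
    | add x y _ _ hx hy => rw [map_add, map_add, hx, hy, map_add]
    | mul x y _ _ hx hy => rw [map_mul, map_mul, hx, hy, map_mul]
  intro f g hfg
  apply Subtype.ext
  apply hΛinj
  rw [← hagree f f.2, ← hagree g g.2]
  exact congrArg ρ hfg

/-- **`dim k[xᵢyⱼ] ≤ a + b − 1`** (for `a ≥ 1`, witnessed by `i₀ : Fin a`). The Segre ring is an affine domain, so its Krull
dimension is its transcendence degree (`exists_ringKrullDim_eq_and_trdeg_eq`, Matsumura Thm. 5.6), which is at most that
of `k[T_v : v ≠ inl i₀]`, i.e. `a + b − 1`, by the injective dehomogenisation `segre_exists_injective_algHom`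
(`trdeg_le_of_injective`, `MvPolynomial.trdeg_of_isDomain`). [folklore; cite: Matsumura1987, Thm. 5.6] -/
theorem segre_ringKrullDim_le (a b : ℕ) (i₀ : Fin a) : ringKrullDim ↥SR[a, b] ≤ (a + b - 1 : ℕ) := by
  classical
  obtain ⟨ψ, hψ⟩ := segre_exists_injective_algHom k a b i₀
  haveI : Algebra.FiniteType k ↥SR[a, b] := Algebra.FiniteType.adjoin_of_finite (Set.finite_range _)
  haveI : FaithfulSMul k ↥SR[a, b] := (faithfulSMul_iff_algebraMap_injective k ↥SR[a, b]).mpr fun x y hxy => by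
    have h := congrArg Subtype.val hxy
    simp only [Subalgebra.coe_algebraMap, MvPolynomial.algebraMap_eq] at h
    exact (C_injective _ _) h
  obtain ⟨n, hn, htr⟩ := exists_ringKrullDim_eq_and_trdeg_eq k ↥SR[a, b]
  have h1 : Algebra.trdeg k ↥SR[a, b] ≤ Algebra.trdeg k (MvPolynomial {v : Fin a ⊕ Fin b // v ≠ Sum.inl i₀} k) :=
    trdeg_le_of_injective ψ hψ
  rw [htr, MvPolynomial.trdeg_of_isDomain, Cardinal.mk_fintype, Cardinal.lift_natCast] at h1
  have h2 : Fintype.card {v : Fin a ⊕ Fin b // v ≠ Sum.inl i₀} = a + b - 1 := by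
    simp only [ne_eq, Fintype.card_subtype_compl, Fintype.card_sum, Fintype.card_fin, Fintype.card_unique]
  rw [h2] at h1
  have h3 : n ≤ a + b - 1 := by exact_mod_cast h1
  rw [hn]
  exact_mod_cast h3

/-! ## The vertex is singular -/

/-- **Degree gap.** An element of the Segre ring has no monomials of degree `1`: every monomial in its support is balanced
(`segreMemIff_balanced_of_mem`), hence of even total degree. [folklore] -/
theorem segreSing_coeff_eq_zero (a b : ℕ) {c : SP[a, b]} (hc : c ∈ SR[a, b]) (d : Fin a ⊕ Fin b →₀ ℕ)
    (h0 : 0 < Finsupp.degree d) (hlt : Finsupp.degree d < 2) : coeff d c = 0 := by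
  by_contra hne
  have hbal := segreMemIff_balanced_of_mem k a b hc d (mem_support_iff.mpr hne)
  have hdeg : Finsupp.degree d = ∑ i : Fin a, d (Sum.inl i) + ∑ j : Fin b, d (Sum.inr j) := by
    rw [Finsupp.degree_eq_sum, Fintype.sum_sum_type]
  omega

/-- **THE VERTEX OF THE SEGRE CONE IS SINGULAR.** Let `q` be a prime of `SR[a,b] = k[xᵢyⱼ]`, `a, b ≥ 2`, containing every
generator `xᵢyⱼ` (so `t ∈ q ↔ t(0) = 0`, `segreVertex_mem_iff`), and suppose `dim SR[a,b] ≤ m < ab`. Then `SR[a,b]_q` is not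
a regular local ring: otherwise `q SR[a,b]_q` has `≤ ht q ≤ m` generators, denominators clear to `a₁,…,a_{m'} ∈ q`,
`m' ≤ m` (`veronese_not_isRegularRing_exists_finset`), and taking degree-`2` components
(`veroneseSing_homogeneousComponent_mul` with `r = 2`: `(c y)₂ = c(0) • y₂` for `y(0) = 0`, as elements of `SR[a,b]` have no
degree-`1` monomials, `segreSing_coeff_eq_zero`) puts the `ab` linearly independent monomials `xᵢyⱼ ∈ q` in the span of
`(a₁)₂,…,(a_{m'})₂`: `ab ≤ m' ≤ m`. (Embedding dimension of the vertex `= ab`.) [folklore; cf. BrunsHerzog1998, Ex. 2.2.24] -/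
theorem segreSing_vertex_not_regular (a b : ℕ) {m : ℕ} (hdim : ringKrullDim ↥SR[a, b] ≤ m) (hm : m < a * b)
    (q : PrimeSpectrum ↥SR[a, b])
    (hq : ∀ v : ↥SR[a, b], (∃ ij : Fin a × Fin b,
      (v : SP[a, b]) = MvPolynomial.X (Sum.inl ij.1) * MvPolynomial.X (Sum.inr ij.2)) → v ∈ q.asIdeal) :
    ¬ IsRegularLocalRing (Localization.AtPrime q.asIdeal) := by
  classical
  intro hreg
  -- membership in the vertex is vanishing of the constant coefficient
  have hmem : ∀ t : ↥SR[a, b], t ∈ q.asIdeal ↔ constantCoeff (t : SP[a, b]) = 0 :=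
    segreVertex_mem_iff k a b q.asIdeal hq
  -- `SR[a,b]_q` is regular local of dimension `ht q ≤ dim SR[a,b] ≤ m`: `≤ m` generators
  have hgen : (IsLocalRing.maximalIdeal (Localization.AtPrime q.asIdeal)).spanFinrank ≤ m := by
    have h := hreg.spanFinrank_maximalIdeal.trans_le
      ((IsLocalization.AtPrime.ringKrullDim_eq_height q.asIdeal
        (Localization.AtPrime q.asIdeal)).trans_le
        (Ideal.height_le_ringKrullDim_of_isPrime.trans hdim))
    exact_mod_cast h
  haveI : IsNoetherianRing (Localization.AtPrime q.asIdeal) := hreg.toIsNoetherian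
  obtain ⟨s, hscard, hsm, hsgen⟩ := veronese_not_isRegularRing_exists_finset q.asIdeal
    (IsNoetherian.noetherian _) hgen
  -- the degree-`2` component `f` of an element of `SR[a,b]`
  set f : ↥SR[a, b] → SP[a, b] := fun y => homogeneousComponent 2 (y : SP[a, b]) with hf
  have hgap : ∀ c : ↥SR[a, b], ∀ d : Fin a ⊕ Fin b →₀ ℕ, 0 < Finsupp.degree d → Finsupp.degree d < 2 →
      coeff d (c : SP[a, b]) = 0 := fun c d h0 hlt => segreSing_coeff_eq_zero k a b c.2 d h0 hlt
  have hf_add : ∀ y z : ↥SR[a, b], f (y + z) = f y + f z := by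
    intro y z
    simp only [hf, Subalgebra.coe_add, map_add]
  have hf_mul : ∀ c y : ↥SR[a, b], constantCoeff (y : SP[a, b]) = 0 →
      f (c * y) = constantCoeff (c : SP[a, b]) • f y := by
    intro c y hy0
    simp only [hf, Subalgebra.coe_mul]
    exact veroneseSing_homogeneousComponent_mul k 2 (hgap c) hy0
  -- the degree-`2` components of elements of `q` lie in the span `V` of those of `s` ...
  have hV : ∀ g : ↥SR[a, b], g ∈ q.asIdeal →
      f g ∈ Submodule.span k (↑(s.image f) : Set SP[a, b]) := by
    intro g hg
    obtain ⟨u, hu, hug⟩ := hsgen g hg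
    have hu0 : constantCoeff (u : SP[a, b]) ≠ 0 := fun h => hu ((hmem u).mpr h)
    have key : u * g ∈ q.asIdeal ∧
        f (u * g) ∈ Submodule.span k (↑(s.image f) : Set SP[a, b]) := by
      refine Submodule.span_induction
        (p := fun y _ => y ∈ q.asIdeal ∧
          f y ∈ Submodule.span k (↑(s.image f) : Set SP[a, b])) ?_ ?_ ?_ ?_ hug
      · intro z hz
        exact ⟨hsm z hz, Submodule.subset_span
          (Finset.mem_coe.mpr (Finset.mem_image_of_mem f (Finset.mem_coe.mp hz)))⟩
      · refine ⟨Ideal.zero_mem _, ?_⟩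
        have h0 : f 0 = 0 := by
          simp only [hf, ZeroMemClass.coe_zero, map_zero]
        rw [h0]
        exact Submodule.zero_mem _
      · rintro y z - - ⟨hyq, hy⟩ ⟨hzq, hz⟩
        refine ⟨Ideal.add_mem _ hyq hzq, ?_⟩
        rw [hf_add]
        exact Submodule.add_mem _ hy hz
      · rintro c y - ⟨hyq, hy⟩
        refine ⟨Ideal.mul_mem_left _ c hyq, ?_⟩
        rw [smul_eq_mul, hf_mul c y ((hmem y).mp hyq)]
        exact Submodule.smul_mem _ _ hy
    have h := key.2
    rw [hf_mul u g ((hmem g).mp hg)] at h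
    exact (Submodule.smul_mem_iff _ hu0).mp h
  -- ... which contains every generator `xᵢyⱼ = χ^{ε_{inl i} + ε_{inr j}}`
  let e : Fin a × Fin b → (Fin a ⊕ Fin b →₀ ℕ) := fun ij =>
    Finsupp.single (Sum.inl ij.1) 1 + Finsupp.single (Sum.inr ij.2) 1
  have he_deg : ∀ ij, Finsupp.degree (e ij) = 2 := by
    intro ij
    simp only [e, map_add, Finsupp.degree_single]
  have he_X : ∀ ij : Fin a × Fin b, (monomial (e ij) (1 : k) : SP[a, b]) = X (Sum.inl ij.1) * X (Sum.inr ij.2) :=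
    fun ij => (segreMemIff_X_mul_X_eq_monomial k a b ij.1 ij.2).symm
  have hin : ∀ ij : Fin a × Fin b,
      (monomial (e ij) (1 : k) : SP[a, b]) ∈ (Submodule.span k (↑(s.image f) : Set SP[a, b]) : Set SP[a, b]) := by
    intro ij
    have hy : (⟨monomial (e ij) (1 : k), (he_X ij) ▸ Algebra.subset_adjoin ⟨ij, rfl⟩⟩ : ↥SR[a, b]) ∈ q.asIdeal :=
      hq _ ⟨ij, he_X ij⟩
    have h := hV _ hy
    simp only [hf, homogeneousComponent_eq_self (isHomogeneous_monomial (1 : k) (he_deg ij))] at h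
    exact h
  have he_inj : Function.Injective e := by
    rintro ⟨i, j⟩ ⟨i', j'⟩ h
    have h1 := DFunLike.congr_fun h (Sum.inl i')
    have h2 := DFunLike.congr_fun h (Sum.inr j')
    simp only [e, Finsupp.add_apply, Finsupp.single_apply, Sum.inl.injEq, Sum.inr.injEq, reduceCtorEq, if_true,
      if_false, add_zero, zero_add] at h1 h2
    have hi : i = i' := by
      by_contra hne
      rw [if_neg hne] at h1
      exact zero_ne_one h1
    have hj : j = j' := by
      by_contra hne
      rw [if_neg hne] at h2
      exact zero_ne_one h2
    rw [hi, hj]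
  have hli : LinearIndependent k (fun ij => (monomial (e ij) (1 : k) : SP[a, b])) :=
    (basisMonomials (Fin a ⊕ Fin b) k).linearIndependent.comp e he_inj
  have hrange : Set.range (fun ij => (monomial (e ij) (1 : k) : SP[a, b])) ⊆
      (Submodule.span k (↑(s.image f) : Set SP[a, b]) : Set SP[a, b]) := by
    rintro _ ⟨ij, rfl⟩
    exact hin ij
  have h3 : Cardinal.mk (Fin a × Fin b) ≤ (s.image f).card := by
    simpa only [Finset.coe_sort_coe, Fintype.card_coe] using
      linearIndependent_le_span' _ hli _ hrange
  have h3' : a * b ≤ (s.image f).card := by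
    rw [Cardinal.mk_fintype, Fintype.card_prod, Fintype.card_fin, Fintype.card_fin] at h3
    exact_mod_cast h3
  have h2 : (s.image f).card ≤ m := Finset.card_image_le.trans hscard
  omega

/-! ## The Segre cone is not regular; the packaged statement -/

/-- **The Segre cone `C(ℙᵃ⁻¹ × ℙᵇ⁻¹)` is singular for `a, b ≥ 2`:** `SR[a,b] = k[xᵢyⱼ]` is not a regular ring, since its
localization at the vertex — the kernel of the constant coefficient `SR[a,b] → k`, a prime containing every `xᵢyⱼ` — is not a
regular local ring (`segreSing_vertex_not_regular` with `dim SR[a,b] ≤ a + b − 1 < ab`, `segre_ringKrullDim_le`).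
[folklore; cf. BrunsHerzog1998, Ex. 2.2.24] -/
theorem segreCone_not_isRegularRing (a b : ℕ) (ha : 2 ≤ a) (hb : 2 ≤ b) : ¬ IsRegularRing ↥SR[a, b] := by
  classical
  intro hreg
  -- the vertex: kernel of the constant coefficient
  let ε : ↥SR[a, b] →+* k := (constantCoeff : SP[a, b] →+* k).comp (SR[a, b]).val.toRingHom
  let q : PrimeSpectrum ↥SR[a, b] := ⟨RingHom.ker ε, RingHom.ker_isPrime ε⟩
  have hq : ∀ v : ↥SR[a, b], (∃ ij : Fin a × Fin b,
      (v : SP[a, b]) = MvPolynomial.X (Sum.inl ij.1) * MvPolynomial.X (Sum.inr ij.2)) → v ∈ q.asIdeal := by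
    rintro v ⟨ij, hv⟩
    change ε v = 0
    simp only [ε, RingHom.comp_apply]
    change constantCoeff (v : SP[a, b]) = 0
    rw [hv, map_mul, constantCoeff_X, constantCoeff_X, mul_zero]
  have hlt : a + b - 1 < a * b := by
    have h := add_le_mul ha hb
    omega
  exact segreSing_vertex_not_regular k a b (segre_ringKrullDim_le k a b ⟨0, by omega⟩) hlt q hq
    (@IsRegularRing.isRegularLocalRing_localization _ _ hreg q.asIdeal q.isPrime)

/-- **THE SEGRE CONES: SINGULAR MEMBERS OF THE RESIDUAL CLASS WITH A RESOLUTION, IN EVERY DIMENSION `a + b − 1 ≥ 3` AND EVERY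
CHARACTERISTIC.** For every prime `p`, every field `k` of characteristic `p` and all `a, b ≥ 2`: the Segre ring
`SR[a,b] = k[xᵢyⱼ]` is a domain with every ideal tightly closed (`segreCone_residualClass`; a fortiori the crux hypothesis on
parameter ideals of all stalks, `segreCone_fRationalHypothesis`), is NOT regular (`segreCone_not_isRegularRing`), and
`Spec SR[a,b]` HAS a resolution of singularities (`hasResolution_segreCone`: one blow-up of the vertex). Rung 4′ of the crux holds
on this family unconditionally. [folklore] -/
theorem segreCone_singular_residualClass_hasResolution (p : ℕ) [Fact p.Prime] [CharP k p] (a b : ℕ)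
    (ha : 2 ≤ a) (hb : 2 ≤ b) :
    (IsDomain ↥SR[a, b] ∧ ∀ I : Ideal ↥SR[a, b], ∀ y c : ↥SR[a, b], c ≠ 0 →
      (∀ e : ℕ, c * y ^ p ^ e ∈ Ideal.span ((fun z : ↥SR[a, b] => z ^ p ^ e) '' (I : Set ↥SR[a, b]))) → y ∈ I) ∧
    ¬ IsRegularRing ↥SR[a, b] ∧ Scheme.HasResolution (Spec (CommRingCat.of ↥SR[a, b])) :=
  ⟨segreCone_residualClass k p a b, segreCone_not_isRegularRing k a b ha hb,
    hasResolution_segreCone k a b ⟨0, by omega⟩ ⟨0, by omega⟩⟩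

end Cones

end Summit.ResolutionOfSingularities.ResolutionOfSingularities.Theorems.FRationalResolution

end
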